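import Literature.AlgebraicGeometry.Resolution.AlterationsSemiStableResolution
import Literature.AlgebraicGeometry.Motives.RatFnBirational
import HarnessLib

/-!
# `WildQuotients.SummitReduction` (stmt-ResolutionOfSingularities-16324), line `FramePerfect`:
# bookkeeping lemmas for stub 2 (`stub_pair_semiStablePairResolution`, de Jong 1997, Prop. 5.11)

Route `ResolutionOfSingularities/WildQuotients`, crux `SummitReduction`; helper file of the line
skeleton `Cruxes/SummitReduction/Lines/FramePerfect.lean` (v5). Stub 2 asks, for a `G`-semi-stable
pair `(f : X → Y, D, τ)` (de Jong 1997, Prop. 5.11: a quasi-split semi-stable curve over a regular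
`Y`, smooth outside a `G`-stable `G`-strict strict normal crossings divisor `D`, disjoint sections
`τᵢ` into the smooth locus permuted by `G`), for the PAIR-FORMAT conclusion of de Jong's equivariant
alteration theorem: a finite group `G₁ ↠ G`, a regular integral projective `X₁` with a `G₁`-action,
an equivariant alteration `π₁ : X₁ ⟶ X` with `K(X)^G ⊂ K(X₁)^{G₁}` purely inseparable (on function
fields: every `G₁`-invariant `a` has `a ^ q ^ n = π₁♯ c` with `c ∈ K(X)^G`), and a `G₁`-stable
`G₁`-strict strict normal crossings divisor `D₁ ⊇ π₁⁻¹ Z`, `Z = ⋃ᵢ τᵢ(Y) ∪ f⁻¹(D)`. De Jong's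
solution is a `G`-EQUIVARIANT MODIFICATION (blow-ups in `G`-orbits of components of `Sing X`, then
the canonical blow-up of de Jong 1996, 7.2), with `G₁ = G`. This file proves, hypothesis-free, the
transfer from such a geometric output to the pair format, and the `G`-stability bookkeeping of the
boundary used when the modifications are composed:

* `functionFieldMap_bijective_of_isModification` — a modification (de Jong 1996, 2.17: proper
  birational with integral source) induces an isomorphism of function fields;
* `functionFieldMap_equivariant`, `invariants_of_equivariant_of_mem_range` — along a
  `φ`-equivariant dominant `π : X₁ ⟶ X`, `φ : G₁ ↠ G`, a `G₁`-invariant rational function in the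
  image of `π♯` is `π♯` of a `G`-invariant one (exponent `n = 0` in 5.3 (d));
* `image_eq_of_forall_image_subset`, `semiStableBoundary_image_eq`,
  `preimage_image_eq_of_equivariant` — the boundary `Z` of a `G`-semi-stable pair is `G`-stable,
  and preimages of `G`-stable sets along equivariant maps are `G`-stable;
* `pair_conclusion_of_equivariant_modification` — a `G`-equivariant modification `π₁ : X₁ ⟶ X`
  with `X₁` regular and projective and a `G`-stable `G`-strict strict normal crossings divisor
  `D₁ ⊇ π₁⁻¹ Z` yields the pair-format conclusion verbatim (with `G₁ := G`, `φ₁ := id`).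

So stub 2 is reduced to its geometric core (the three printed blocks of the proof of 5.11, stated
and assembled in the sibling file `…WildQuotientsSummitReductionSemiStablePairBlocks`).
-/

set_option linter.dupNamespace false

noncomputable section

open CategoryTheory CategoryTheory.Limits AlgebraicGeometry TopologicalSpace
open Literature.AlgebraicGeometry.Resolution
open Literature.AlgebraicGeometry.Motives (RatFn.functionFieldMap RatFn.functionFieldMap_comp)
open Literature.AlgebraicGeometry

namespace Summit.ResolutionOfSingularities.ResolutionOfSingularities.Theorems

/-! ## Function fields along modifications and equivariant maps -/

/-- **A modification induces an isomorphism of function fields** (de Jong 1996, 2.17: a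
modification is proper and birational, i.e. an isomorphism over a dense open with dense preimage;
Görtz–Wedhorn I, Def. 9.33). [cite: DeJong1996, 2.17, pp. 59–60] -/
theorem functionFieldMap_bijective_of_isModification {X₁ X : Scheme.{0}} [IsIntegral X₁]
    [IsIntegral X] (π : X₁ ⟶ X) [IsDominant π] (h : IsModification π) :
    Function.Bijective (RatFn.functionFieldMap π) := by
  obtain ⟨U, hU, hU', hiso⟩ := h.isBirational
  exact Motives.RatFn.functionFieldMap_bijective_of_isIso_morphismRestrict π U hU hU'

/-- **Equivariance on function fields.** If `π : X₁ ⟶ X` is dominant and `φ`-equivariant,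
`(ρ₁ g) ≫ π = π ≫ ρ (φ g)`, then `(ρ₁ g)♯ (π♯ c) = π♯ ((ρ (φ g))♯ c)` for every rational function
`c` on `X` (contravariance of `♯`). [folklore] -/
theorem functionFieldMap_equivariant {X₁ X : Scheme.{0}} [IsIntegral X₁] [IsIntegral X]
    (π : X₁ ⟶ X) [IsDominant π] {G₁ G : Type} [Group G₁] [Group G] (ρ₁ : G₁ →* Aut X₁)
    (ρ : G →* Aut X) (φ : G₁ →* G) (hequiv : ∀ g : G₁, (ρ₁ g).hom ≫ π = π ≫ (ρ (φ g)).hom)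
    (g : G₁) (c : X.functionField) :
    RatFn.functionFieldMap (ρ₁ g).hom (RatFn.functionFieldMap π c) =
      RatFn.functionFieldMap π (RatFn.functionFieldMap (ρ (φ g)).hom c) := by
  have h1 : RatFn.functionFieldMap ((ρ₁ g).hom ≫ π) =
      (RatFn.functionFieldMap (ρ₁ g).hom).comp (RatFn.functionFieldMap π) :=
    RatFn.functionFieldMap_comp π (ρ₁ g).hom
  have h2 : RatFn.functionFieldMap (π ≫ (ρ (φ g)).hom) =
      (RatFn.functionFieldMap π).comp (RatFn.functionFieldMap (ρ (φ g)).hom) :=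
    RatFn.functionFieldMap_comp (ρ (φ g)).hom π
  -- `♯` depends only on the morphism (the dominance instance is a proposition)
  have hcongr : ∀ (u v : X₁ ⟶ X) [IsDominant u] [IsDominant v], u = v →
      RatFn.functionFieldMap u = RatFn.functionFieldMap v := by
    intro u v _ _ e
    subst e
    rfl
  have h3 := hcongr _ _ (hequiv g)
  rw [h1, h2] at h3
  simpa using congrArg (fun F => F c) h3

/-- **Invariants along an equivariant map, for elements in the image of `π♯`** (the case
`n = 0` of de Jong 1997, 5.3 (d)): if `π : X₁ ⟶ X` is dominant and `φ`-equivariant for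
`φ : G₁ ↠ G` and `a = π♯ c`, then `a` `G₁`-invariant forces `c` `G`-invariant (`π♯` is injective,
being a field map), so `a ^ q ^ 0 = π♯ c` with `c ∈ K(X)^G`. [cite: DeJong1997, 5.3, p. 613] -/
theorem invariants_of_equivariant_of_mem_range {X₁ X : Scheme.{0}} [IsIntegral X₁] [IsIntegral X]
    (π : X₁ ⟶ X) [IsDominant π] {G₁ G : Type} [Group G₁] [Group G] (ρ₁ : G₁ →* Aut X₁)
    (ρ : G →* Aut X) (φ : G₁ →* G) (hφ : Function.Surjective φ)
    (hequiv : ∀ g : G₁, (ρ₁ g).hom ≫ π = π ≫ (ρ (φ g)).hom) (a : X₁.functionField)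
    (ha : ∀ g : G₁, RatFn.functionFieldMap (ρ₁ g).hom a = a)
    (hac : a ∈ Set.range (RatFn.functionFieldMap π)) :
    ∃ (n : ℕ) (c : X.functionField), (∀ g : G, RatFn.functionFieldMap (ρ g).hom c = c) ∧
      a ^ ringExpChar X.functionField ^ n = RatFn.functionFieldMap π c := by
  obtain ⟨c, rfl⟩ := hac
  refine ⟨0, c, fun g => ?_, by rw [pow_zero, pow_one]⟩
  obtain ⟨g₁, rfl⟩ := hφ g
  apply (RatFn.functionFieldMap π).injective
  rw [← functionFieldMap_equivariant π ρ₁ ρ φ hequiv g₁ c, ha g₁]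

/-! ## `G`-stable subsets: images under an action, boundaries, preimages -/

/-- If every element of a group acting on a scheme maps the subset `S` into itself, then each maps
it ONTO itself (apply the hypothesis to `g⁻¹`). [folklore] -/
theorem image_eq_of_forall_image_subset {X : Scheme.{0}} {G : Type} [Group G] (ρ : G →* Aut X)
    (S : Set X) (h : ∀ g : G, (ρ g).hom.base '' S ⊆ S) (g : G) : (ρ g).hom.base '' S = S := by
  refine (h g).antisymm fun x hx => ⟨(ρ g⁻¹).hom.base x, h g⁻¹ ⟨x, hx, rfl⟩, ?_⟩
  have hcomp : (ρ g⁻¹).hom ≫ (ρ g).hom = 𝟙 X := by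
    rw [map_inv, CategoryTheory.Aut.Aut_inv_def]
    simp
  rw [← Scheme.Hom.comp_apply, hcomp]
  simp

/-- **The boundary of a `G`-semi-stable pair is `G`-stable**: if `f` is equivariant, `D` is
`G`-stable and the sections are permuted by `G` (`τᵢ ≫ ρ_X g = ρ_Y g ≫ τⱼ`), then
`ρ_X g` maps `Z = ⋃ᵢ τᵢ(Y) ∪ f⁻¹(D)` onto itself. [cite: DeJong1997, Prop. 5.11 (ii), p. 618] -/
theorem semiStableBoundary_image_eq {X Y : Scheme.{0}} (f : X ⟶ Y) (D : Set Y) {m : ℕ}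
    (τ : Fin m → (Y ⟶ X)) {G : Type} [Group G] (ρX : G →* Aut X) (ρY : G →* Aut Y)
    (hρf : ∀ g : G, (ρX g).hom ≫ f = f ≫ (ρY g).hom)
    (hDG : ∀ g : G, (ρY g).hom.base '' D = D)
    (hτG : ∀ (g : G) (i : Fin m), ∃ j : Fin m, τ i ≫ (ρX g).hom = (ρY g).hom ≫ τ j) (g : G) :
    (ρX g).hom.base '' DeJong1996.semiStableBoundary f D τ = DeJong1996.semiStableBoundary f D τ := by
  refine image_eq_of_forall_image_subset ρX _ (fun g => ?_) g
  rintro _ ⟨x, hx, rfl⟩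
  rw [DeJong1996.mem_semiStableBoundary_iff] at hx ⊢
  rcases hx with ⟨i, y, rfl⟩ | hx
  · obtain ⟨j, hj⟩ := hτG g i
    refine Or.inl ⟨j, (ρY g).hom.base y, ?_⟩
    change ((ρY g).hom ≫ τ j).base y = (τ i ≫ (ρX g).hom).base y
    rw [hj]
  · right
    change ((ρX g).hom ≫ f).base x ∈ D
    rw [hρf g, Scheme.Hom.comp_apply, ← hDG g]
    exact ⟨f.base x, hx, rfl⟩

/-- **Preimages of `G`-stable subsets along equivariant maps are `G`-stable.** [folklore] -/
theorem preimage_image_eq_of_equivariant {X' X : Scheme.{0}} (ψ : X' ⟶ X) {G : Type} [Group G]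
    (ρ' : G →* Aut X') (ρ : G →* Aut X) (hequiv : ∀ g : G, (ρ' g).hom ≫ ψ = ψ ≫ (ρ g).hom)
    (S : Set X) (hS : ∀ g : G, (ρ g).hom.base '' S = S) (g : G) :
    (ρ' g).hom.base '' (ψ.base ⁻¹' S) = ψ.base ⁻¹' S := by
  refine image_eq_of_forall_image_subset ρ' _ (fun g => ?_) g
  rintro _ ⟨x, hx, rfl⟩
  show ψ.base ((ρ' g).hom.base x) ∈ S
  rw [← Scheme.Hom.comp_apply, hequiv g, Scheme.Hom.comp_apply, ← hS g]
  exact ⟨_, hx, rfl⟩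

/-! ## From an equivariant modification to the pair format -/

/-- **The pair-format conclusion from a `G`-equivariant modification** (bookkeeping of de Jong
1997, Prop. 5.11 ⟹ (5.12.1) for the pair): let `π₁ : X₁ ⟶ X` be a modification (de Jong 1996,
2.17) of the integral `X`, equivariant for actions `ρ₁`, `ρ` of the finite group `G`, with `X₁`
regular and projective over `k`, and let `D₁ ⊇ π₁⁻¹ Z` be a `G`-stable `G`-strict strict normal
crossings divisor on `X₁`. Then `(G, X₁, ρ₁, id, π₁, D₁)` is a solution in the pair format: a
modification is an alteration (2.20) and dominant, `id : G → G` is onto, and since `π₁♯` is an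
isomorphism of function fields commuting with the actions, every `G`-invariant `a ∈ K(X₁)` is
`π₁♯ c` with `c ∈ K(X)^G` (exponent `0`). [cite: DeJong1997, Prop. 5.11 and 5.3, pp. 613, 618–619]
[cite: DeJong1996, 2.17, 2.20, pp. 59–61] -/
theorem pair_conclusion_of_equivariant_modification (k : Type) [Field k] {X : Scheme.{0}}
    [IsIntegral X] (p : X ⟶ Spec (.of k)) (Z : Set X) (G : Type) [Group G] [Finite G]
    (ρ : G →* Aut X) (X₁ : Scheme.{0}) (π₁ : X₁ ⟶ X) (hπ₁ : IsModification π₁)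
    (ρ₁ : G →* Aut X₁) (hequiv : ∀ g : G, (ρ₁ g).hom ≫ π₁ = π₁ ≫ (ρ g).hom)
    (hreg : Scheme.IsRegular X₁) (hproj : Motives.IsProjectiveOver (Over.mk (π₁ ≫ p)))
    (D₁ : Set X₁) (hD₁ : IsStrictNormalCrossingsDivisor X₁ D₁) (hZ : π₁.base ⁻¹' Z ⊆ D₁)
    (hDG : ∀ g : G, (ρ₁ g).hom.base '' D₁ = D₁)
    (hDstrict : ∀ (g : G) (C : Set X₁), Maximal (fun C : Set X₁ => IsIrreducible C ∧ C ⊆ D₁) C →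
      (C ∩ (ρ₁ g).hom.base '' C).Nonempty → (ρ₁ g).hom.base '' C = C) :
    ∃ (G₁ : Type) (_ : Group G₁) (_ : Finite G₁) (X₁ : Scheme.{0}) (_ : IsIntegral X₁)
      (ρ₁ : G₁ →* Aut X₁) (φ₁ : G₁ →* G) (π₁ : X₁ ⟶ X) (_ : IsDominant π₁),
      Function.Surjective φ₁ ∧ IsAlteration π₁ ∧ Scheme.IsRegular X₁ ∧
      Motives.IsProjectiveOver (Over.mk (π₁ ≫ p)) ∧
      (∀ g : G₁, (ρ₁ g).hom ≫ π₁ = π₁ ≫ (ρ (φ₁ g)).hom) ∧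
      (∀ a : X₁.functionField, (∀ g : G₁, RatFn.functionFieldMap (ρ₁ g).hom a = a) →
        ∃ (n : ℕ) (c : X.functionField), (∀ g : G, RatFn.functionFieldMap (ρ g).hom c = c) ∧
          a ^ ringExpChar X.functionField ^ n = RatFn.functionFieldMap π₁ c) ∧
      ∃ D₁ : Set X₁, IsStrictNormalCrossingsDivisor X₁ D₁ ∧ π₁.base ⁻¹' Z ⊆ D₁ ∧
        (∀ g : G₁, (ρ₁ g).hom.base '' D₁ = D₁) ∧
        (∀ (g : G₁) (C : Set X₁), Maximal (fun C : Set X₁ => IsIrreducible C ∧ C ⊆ D₁) C →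
          (C ∩ (ρ₁ g).hom.base '' C).Nonempty → (ρ₁ g).hom.base '' C = C) := by
  haveI : IsIntegral X₁ := hπ₁.isIntegral
  haveI : IsDominant π₁ := hπ₁.isDominant
  refine ⟨G, inferInstance, inferInstance, X₁, inferInstance, ρ₁, MonoidHom.id G, π₁, inferInstance,
    fun g => ⟨g, rfl⟩, hπ₁.isAlteration, hreg, hproj, fun g => by simpa using hequiv g, ?_,
    D₁, hD₁, hZ, hDG, hDstrict⟩
  intro a ha
  exact invariants_of_equivariant_of_mem_range π₁ ρ₁ ρ (MonoidHom.id G) (fun g => ⟨g, rfl⟩)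
    (fun g => by simpa using hequiv g) a ha
    ((functionFieldMap_bijective_of_isModification π₁ hπ₁).2 a)

end Summit.ResolutionOfSingularities.ResolutionOfSingularities.Theorems

end
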